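import Summits.QuantumFields.YangMills.Theorems.BalabanUVNodesK1R9VersionSlotOfAEAtRecord
import Summits.QuantumFields.YangMills.Theorems.BalabanUVNodesN13UV01LevelZeroAtRecord13SignFree

/-!
# BalabanUVNodes ∕ N13 — THE K1⁹ (B)-SLOT AT THE RECORD WITH ITS LEVEL-0 FACE DISCHARGED: Theorem 1's clause + [III] Cor. 3 (2.50) `dV_k`-A.E. AT LEVELS `k ≥ 1` ONLY
# (+ the β-floor letter `BetaLowerH (−β′) γ β_θ`, the normalisation letters `Efl = logz = 0`, `γ ≤ 1`) ⟹ `∃ v, B16.EndStatementBPrinted (Node00.datumOfRecord₁₃SepCoPHV F 2 θ h v).C`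

Cell `pub-ymgap` (HUMAN RULING D-0062 Track A ∕ D-0149 width), WIDTH SEAT `pub-ymgap-dag-n13-w1` (gen 5, CLAIM-4), key K1⁸ `StabilityBRunRowsAtRecordR13SepCoPH` = stmt-QuantumFields-26907
(`--kind proof --supports … --as helper`; count-neutral).  Composition of this seat's ROUTE-FREE junction `…K1R9VersionSlotOfAEAtRecord.exists_revision₁₃_endStatementBPrinted_of_ae` (CLAIM-3a)
with this lineage's gen-0 LEVEL-0 face `…N13UV01LevelZeroAtRecord13SignFree.uvIneq_zero_datumOfRecord₁₃CoPH_of_Efl_logz_of_inInterval_of_betaLowerH_neg` (p590719: (2.50) at `k = 0` at EVERY field,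
exponents `em₀(g) = 4·max(log σ₀,0) + 12·g⁻²`, `ep₀′(g) = 4·(d(𝔤)·(log g⁻¹ + β′) + max(−log σ₀,0))`, under `Efl = logz = 0`, `γ ≤ 1`, `0 ≤ β′`, `BetaLowerH (−β′) γ β_θ`).  The two exponent
pairs are merged by `max` (monotonicity of (2.50) in both exponents; the lower one needs `χ ≥ 0`, true for the (2.9) cut-off of record).  ROUTE-FREE.
[III] = [Balaban1988Convergent], [B16] = [Balaban1989LargeFieldII], [I] = [Balaban1987RG1].

WHAT.  §1 `uvIneq_mono_lower` ((2.50) weakens as `Em` grows, given `0 ≤ χ`), `chi_datumOfRecord₁₃SepCoPH_nonneg` (`χ^{(2.9)} ≥ 0` at the record); §2 ★★★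
`exists_revision₁₃_endStatementBPrinted_of_aeSucc_of_betaLowerH` — at `(θ, h)`: `Efl = logz = 0` on every run, `0 < γ ≤ 1`, `0 ≤ β′`, `BetaLowerH (−β′) γ β_θ`, `B16.Thm1Printed (datum).C`, and
(2.50) with SOME `em ep` for `dV_{k+1}`-ALMOST EVERY field at levels `k+1 ≤ K` on the γ-windowed runs ⟹ `∃ v : Node00.Revision₁₃ F 2 θ h, B16.EndStatementBPrinted (Node00.datumOfRecord₁₃SepCoPHV F 2 θ h v).C`.
So, after the (δ) repair, the (B) conjunct of the K1 item at the record costs EXACTLY: Theorem 1's clause, the a.e. Cor-3 rows at levels ≥ 1 (the N13 suppliers' content, version-free), and the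
β-floor ∕ normalisation letters of the witness.

HONEST FRAMING.  Count-neutral by-name composition; nothing of Bałaban's asserted or refuted; (2.50) at levels ≥ 1 NOT proved; the β-floor letter NOT proved; K1⁸ ∕ K1⁹ NEITHER proved NOR
refuted; N13 NOT discharged; no stub closed; counts unmoved (typed 28∕28 · discharged 5∕27, A 5∕28); one finite `𝕋⁴_{L^K}` programme at fixed ε; R4 closes the CONDITIONAL finite-𝕋⁴ rung
`BalabanLadder.UV` only — the Yang–Mills mass gap (Clay) is NOT proved by any of this.  No `sorry`, `def`, `instance`, `notation`; standard axioms.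
-/

noncomputable section

open scoped BigOperators ENNReal NNReal Matrix.Norms.L2Operator

namespace Summit.QuantumFields.YangMills.BalabanUVNodes.K1R9SlotOfAESuccLevelZeroAtRecord

open MeasureTheory
open Literature.MathematicalPhysics.QuantumFieldTheory.Balaban1983to89
open Literature.MathematicalPhysics.QuantumFieldTheory.Balaban1983to89.T4Continuum (T4Family FiniteEpsData)
open Literature.MathematicalPhysics.QuantumFieldTheory.Balaban1983to89.Node00
open Literature.MathematicalPhysics.QuantumFieldTheory.Balaban1983to89.FlowStepRuns (genFlow genSeq)
open Literature.MathematicalPhysics.QuantumFieldTheory.Balaban1983to89.FlowStep (BetaLowerH)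
open Literature.MathematicalPhysics.QuantumFieldTheory.Balaban1983to89.T4DatumAssembly.TowerReviseAE (uvIneq_mono_upper)
open Summit.QuantumFields.YangMills.BalabanUVNodes.K1R9VersionSlotOfAEAtRecord (exists_revision₁₃_endStatementBPrinted_of_ae)
open Summit.QuantumFields.YangMills.BalabanUVNodes.N13UV01LevelZeroAtRecord13SignFree
  (uvIneq_zero_datumOfRecord₁₃CoPH_of_Efl_logz_of_inInterval_of_betaLowerH_neg)

variable {F : T4Family}

/-! ## §1 Monotonicity of (2.50) in the lower exponent; the cut-off of record is non-negative -/

/-- (2.50) is MONOTONE in the lower exponent when `χ ≥ 0`: enlarging `Em` keeps it. [cite: Balaban1989LargeFieldII, (0.1) pp.355–356 (bookkeeping)] -/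
theorem uvIneq_mono_lower {D : B16.RunData} {k : ℕ} {V : D.Cfg k} {Em Em' Ep : ℝ} (hχ : 0 ≤ D.χ k V) (h : B16.UVIneq D k V Em Ep) (hle : Em ≤ Em') :
    B16.UVIneq D k V Em' Ep := by
  refine ⟨le_trans ?_ h.1, h.2⟩
  refine mul_le_mul_of_nonneg_left (Real.exp_le_exp.mpr ?_) hχ
  have hT : (0 : ℝ) ≤ (D.numSites k : ℝ) := Nat.cast_nonneg _
  nlinarith [mul_le_mul_of_nonneg_right hle hT]

/-- The (2.9) cut-off of the record's datum is non-negative at every field (`Node00.chiFix29OfRecord_mem_Icc`). [cite: Balaban1987RG1, (2.9) p.266 (bookkeeping)] -/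
theorem chi_datumOfRecord₁₃SepCoPH_nonneg (θ : Stage13HParams F 2) (h : θ.Provisos₁₃SepCoPH F 2) (p : B12.RunParams) (k : ℕ)
    (V : GaugeField (F.P p.K) k (SU 2)) : 0 ≤ ((datumOfRecord₁₃SepCoPH F 2 θ h).C p).χ k V := by
  show 0 ≤ chiFix29OfRecord F 2 θ.ν θ.ε₂₉ p.K k V
  exact (chiFix29OfRecord_mem_Icc θ.ν θ.ε₂₉ p.K k V).1

/-! ## §2 The K1⁹ (B)-slot from Theorem 1's clause + the a.e. Cor-3 rows at levels ≥ 1 + the β-floor ∕ normalisation letters -/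

open Classical in
/-- **★★★ THE K1⁹ (B)-SLOT AT THE RECORD WITH ITS LEVEL-0 FACE DISCHARGED.**  At `(θ, h)`: normalisation letters `Efl = logz = 0` on every run, `0 < γ ≤ 1`, `0 ≤ β′`, the β-floor
`BetaLowerH (−β′) γ β_θ` on the γ-box, Theorem 1's clause `B16.Thm1Printed (datumOfRecord₁₃SepCoPH F 2 θ h).C`, and (2.50) with SOME dependence functions `em ep` for `dV_{k+1}`-ALMOST EVERY
field at every level `k+1 ≤ K` of every γ-windowed run ⟹ `∃ v : Node00.Revision₁₃ F 2 θ h, B16.EndStatementBPrinted (Node00.datumOfRecord₁₃SepCoPHV F 2 θ h v).C`.  PROOF: level 0 at EVERY field by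
this lineage's p590719 with `(em₀, ep₀′)`; both exponent pairs merged by `max` (§1 + `TowerReviseAE.uvIneq_mono_upper`); then the junction `K1R9VersionSlotOfAEAtRecord.exists_revision₁₃_endStatementBPrinted_of_ae`.
[cite: Balaban1989LargeFieldII, Thm 1 + (0.1) pp.355–356; Balaban1988Convergent, Cor. 3 (2.50) p.264, Thm 1 p.262; Balaban1987RG1, (0.20) p.256, (1.22) p.264 (bookkeeping; a composition of landed files)] -/
theorem exists_revision₁₃_endStatementBPrinted_of_aeSucc_of_betaLowerH (θ : Stage13HParams F 2) (h : θ.Provisos₁₃SepCoPH F 2)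
    (hEfl : ∀ (P : B12.RunParams) (j : ℕ), θ.Efl P j = 0) (hlogz : ∀ (P : B12.RunParams) (j : ℕ), θ.logz P j = 0)
    {γ β' : ℝ} (hγ : 0 < γ) (hγ1 : γ ≤ 1) (hβ' : 0 ≤ β') (hβ : BetaLowerH (-β') γ (betaOfRecord₁₃ F 2 θ.toStage13Params))
    (h1 : B16.Thm1Printed (datumOfRecord₁₃SepCoPH F 2 θ h).C) (em ep : ℝ → ℝ)
    (hae : ∀ p : B12.RunParams, ((datumOfRecord₁₃SepCoPH F 2 θ h).C p).flow.InInterval γ p.K → ∀ k : ℕ, k + 1 ≤ p.K →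
      ∀ᵐ V ∂fieldMeasure (F.P p.K) (k + 1) (SU 2),
        B16.UVIneq ((datumOfRecord₁₃SepCoPH F 2 θ h).C p) (k + 1) V (em (((datumOfRecord₁₃SepCoPH F 2 θ h).C p).flow.g (k + 1)))
          (ep (((datumOfRecord₁₃SepCoPH F 2 θ h).C p).flow.g (k + 1)))) :
    ∃ v : Revision₁₃ F 2 θ h, B16.EndStatementBPrinted (datumOfRecord₁₃SepCoPHV F 2 θ h v).C := by
  -- the level-0 exponents of record and the merged pair
  let em₀ : ℝ → ℝ := fun g => 4 * max θ.ν.logσ₀ 0 + 12 * (1 / g) ^ 2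
  let ep₀ : ℝ → ℝ := fun g => 4 * ((dimSU 2 : ℕ) * (Real.log g⁻¹ + β') + max (-θ.ν.logσ₀) 0)
  let em' : ℝ → ℝ := fun g => max (em g) (em₀ g)
  let ep' : ℝ → ℝ := fun g => max (ep g) (ep₀ g)
  refine exists_revision₁₃_endStatementBPrinted_of_ae θ h hγ em' ep' h1 ?_ ?_
  · -- level 0 at EVERY field: the lineage's sign-free level-0 face, then enlarge both exponents
    intro p hp V
    have h0 := uvIneq_zero_datumOfRecord₁₃CoPH_of_Efl_logz_of_inInterval_of_betaLowerH_neg θ h.toCore p (hEfl p) (hlogz p) hγ1 hβ' hβ hp V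
    have h0' : B16.UVIneq ((datumOfRecord₁₃SepCoPH F 2 θ h).C p) 0 V (em₀ (((datumOfRecord₁₃SepCoPH F 2 θ h).C p).flow.g 0))
        (ep₀ (((datumOfRecord₁₃SepCoPH F 2 θ h).C p).flow.g 0)) := h0
    exact uvIneq_mono_upper (uvIneq_mono_lower (chi_datumOfRecord₁₃SepCoPH_nonneg θ h p 0 V) h0' (le_max_right _ _)) (le_max_right _ _)
  · -- levels ≥ 1 a.e.: enlarge both exponents inside the a.e. statement
    intro p hp k hk
    filter_upwards [hae p hp k hk] with V hV
    exact uvIneq_mono_upper (uvIneq_mono_lower (chi_datumOfRecord₁₃SepCoPH_nonneg θ h p (k + 1) V) hV (le_max_left _ _)) (le_max_left _ _)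

end Summit.QuantumFields.YangMills.BalabanUVNodes.K1R9SlotOfAESuccLevelZeroAtRecord

end
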